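import Literature.AlgebraicGeometry.Motives.CechCoherentDevissage
import Literature.AlgebraicGeometry.Motives.CechComplexPseudoCoherentDescent
import HarnessLib

/-!
# `cechComplex_pseudoCoherent_general` from Chow families (Görtz–Wedhorn II, Thm. 23.133 via
# Thm. 23.17: the dévissage step assembled)

`Motives/CechComplexPseudoCoherentDescent` reduces the named fact
`cechComplex_pseudoCoherent_general` (`Motives/GrothendieckComplexSectionAlongCech`) to the
finiteness over `A = Γ(T, 𝒪_T)` of the Čech cohomology modules `Hⁿ(Č•(𝔚, 𝒪(D)))` for `T` affine
integral noetherian and `X ×_K T → T` proper (`cechComplex_pseudoCoherent_general_of_finite_cohomology`).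
`Motives/CechCoherentDevissage` proves that finiteness for every coherent rank-one family
`𝓛 ⊆ 𝒦_V` on every integral closed subscheme `V` of a proper `Z₀ → B`, `B` affine noetherian
(`FracFamily.moduleFinite_homology_of_isCoherent`; Görtz–Wedhorn II, Thm. 23.17 / Cor. 23.18 by
noetherian induction and dévissage), GIVEN the "Chow families": on every such `V` and every finite
affine cover a coherent `𝓖 ∋ 1` with finitely generated Čech cohomology (assertion (3) of the
printed proof of Thm. 23.17, p. 425, there obtained from Chow's lemma and Serre's theorem).

This file assembles the two (`cechComplex_pseudoCoherent_general_of_chowFamilies`): the Čech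
cover `𝔚` of `X ×_K T` over `V = T` adapted to `D` is a cover with affine intersections
(`CartierDivisor.CechCover.coverData`; `pr_T` is separated and `T` affine), the family
`s ↦ Γ(W_s, 𝒪(D)) ⊆ K(X ×_K T)` is coherent (`CartierDivisor.CechCover.isCoherent_sectionsOn`:
generated by `f_{c(a)}⁻¹` on `W_s ⊆ W_a ⊆ U_{c(a)}`, Görtz–Wedhorn I, (11.9)) and non-zero, and
`A` acts through `pr_T^*` (`algCompat_baseAlgebra`). What then remains of the named fact is
exactly the existence of Chow families (Chow's lemma `Resolution/ChowLemmaRing` — proved —,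
Serre's theorems `Literature/Algebra/Homology/SerreFiniteness*`, `SerreVanishing` — proved —, and
the comparison of Čech covers, `Literature/Algebra/Homology/OrderedCechDeletion`).

Everything here is proved; no named facts are introduced. Mathlib searched (pin): no coherent
cohomology of proper morphisms (`Mathlib/AlgebraicGeometry` has `IsProper`, Chow-free).

## References

* U. Görtz, T. Wedhorn, *Algebraic Geometry II: Cohomology of Schemes*, Springer Spektrum (2023),
  doi:10.1007/978-3-658-43031-3: Thm. 23.17 with proof, Cor. 23.18 (PDF pp. 424–425);
  Thm. 23.133 with proof, Cor. 23.135 (PDF pp. 478–480). [GortzWedhorn2023]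
* U. Görtz, T. Wedhorn, *Algebraic Geometry I: Schemes*, 2nd ed. (2020): (11.9), p. 374
  (`𝒪_X(D)|_{U_i} = f_i⁻¹𝒪_{U_i}`). [GortzWedhorn2020]
-/

universe u

open CategoryTheory CategoryTheory.Limits AlgebraicGeometry TopologicalSpace Opposite
open MonoidalCategory CartesianMonoidalCategory

noncomputable section

namespace Literature.AlgebraicGeometry.Motives

open RatFn Literature.Algebra.Homology Literature.Algebra.Homology.OrderedCech FracFamily

/-! ### A Čech cover over an affine base as cover data; coherence of `s ↦ Γ(W_s, 𝒪(D))` -/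

namespace CartierDivisor.CechCover

variable {Y B : Scheme.{u}} [IsIntegral Y] {pr : Y ⟶ B} {D : CartierDivisor Y}
  (𝔚 : CechCover pr ⊤ D)

/-- `W_∅ = pr⁻¹T = Y`. [folklore] -/
theorem opens_empty : 𝔚.opens ∅ = ⊤ := by
  rw [CartierDivisor.CechCover.opens, Scheme.Hom.preimage_top, Finset.inf_empty, top_inf_eq]

/-- **The intersections `W_s` of a Čech cover of `pr : Y → B` over the affine `B` (`pr` separated)
form cover data** in the sense of `Motives/CoherentFracFamily`: affine for `s ≠ ∅`
(`isAffineOpen_opens`), non-empty, covering `Y`. [folklore] -/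
def coverData [IsSeparated pr] [IsAffine B] : CoverData Y (Fin (𝔚.r + 1)) where
  U := 𝔚.opens
  anti _ _ h := 𝔚.opens_anti h
  mem_of_forall t ht y hy := by
    obtain ⟨a, ha⟩ := ht
    exact 𝔚.mem_opens_iff.2 ⟨(𝔚.mem_opens_iff.1 (hy a ha)).1,
      fun b hb => (𝔚.mem_opens_iff.1 (hy b hb)).2 b (Finset.mem_singleton_self b)⟩
  affine _ ht := 𝔚.isAffineOpen_opens (isAffineOpen_top B) ht
  genericPoint_mem := 𝔚.genericPoint_mem_opens
  exists_mem y := by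
    have hy : y ∈ ⨆ a, 𝔚.W a := by rw [𝔚.iSup_W, Scheme.Hom.preimage_top]; trivial
    obtain ⟨a, ha⟩ := Opens.mem_iSup.1 hy
    refine ⟨a, 𝔚.mem_opens_iff.2 ⟨?_, fun b hb => ?_⟩⟩
    · rw [Scheme.Hom.preimage_top]; trivial
    · rw [Finset.mem_singleton.1 hb]; exact ha

/-- The opens of the cover data are the `W_s`. [folklore] -/
@[simp] theorem coverData_U [IsSeparated pr] [IsAffine B] : (𝔚.coverData).U = 𝔚.opens := rfl

/-- `f_{c(a)}⁻¹ ∈ Γ(W_s, 𝒪(D))` for `a ∈ s` (`W_s ⊆ W_a ⊆ U_{c(a)}`). [folklore] -/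
theorem inv_f_mem_sectionsOn {s : Finset (Fin (𝔚.r + 1))} {a : Fin (𝔚.r + 1)} (ha : a ∈ s) :
    letI := baseAlgebra pr ⊤ 𝔚.genericPoint_mem
    (D.f (𝔚.chart a))⁻¹ ∈ 𝔚.sectionsOn s := by
  letI := baseAlgebra pr ⊤ 𝔚.genericPoint_mem
  show D.IsSectionOn _ _
  rw [isSectionOn_iff_of_le ((𝔚.opens_le_W ha).trans (𝔚.W_le_U a))]
  intro y _
  rw [mul_inv_cancel₀ (D.f_ne_zero _)]
  exact isRegularAt_one

/-- `Γ(W_{a}, 𝒪(D)) ≠ 0`. [folklore] -/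
theorem sectionsOn_ne_bot (a : Fin (𝔚.r + 1)) :
    letI := baseAlgebra pr ⊤ 𝔚.genericPoint_mem
    𝔚.sectionsOn {a} ≠ ⊥ := by
  letI := baseAlgebra pr ⊤ 𝔚.genericPoint_mem
  intro h
  have h1 : (D.f (𝔚.chart a))⁻¹ ∈ 𝔚.sectionsOn {a} := 𝔚.inv_f_mem_sectionsOn (Finset.mem_singleton_self a)
  rw [h, Submodule.mem_bot] at h1
  exact inv_ne_zero (D.f_ne_zero _) h1

/-- **`s ↦ Γ(W_s, 𝒪(D)) ⊆ K(Y)` is a coherent family on the cover data of `𝔚`**: it is monotone,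
a `Γ(W_s, 𝒪_Y)`-module, generated over `Γ(W_s, 𝒪_Y)` by `f_{c(a)}⁻¹` (`a ∈ s`;
`Γ(W, 𝒪_Y(D)) = f_i⁻¹Γ(W, 𝒪_Y)` on `W ⊆ U_i`, Görtz–Wedhorn I, (11.9)), and its stalks
`𝒪_{Y,y} f_{c(a)}⁻¹` do not depend on the chart. [cite: GortzWedhorn2020, Section (11.9) (p. 374)] -/
theorem isCoherent_sectionsOn [IsSeparated pr] [IsAffine B] :
    letI := baseAlgebra pr ⊤ 𝔚.genericPoint_mem
    IsCoherent 𝔚.coverData 𝔚.sectionsOn := by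
  letI := baseAlgebra pr ⊤ 𝔚.genericPoint_mem
  haveI : ∀ t, Nonempty (𝔚.opens t) := fun t => ⟨⟨_, 𝔚.genericPoint_mem_opens t⟩⟩
  refine ⟨𝔚.sectionsOn_mono, ?_, ?_, ?_⟩
  · intro t _ b x hx
    exact hx.mul_left fun y hy => isRegularAt_algebraMap_sections (V := 𝔚.opens t) ⟨y, hy⟩ b
  · intro t ht
    obtain ⟨a, ha⟩ := ht
    classical
    have hle : 𝔚.opens t ≤ D.U (𝔚.chart a) := (𝔚.opens_le_W ha).trans (𝔚.W_le_U a)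
    refine ⟨{(D.f (𝔚.chart a))⁻¹}, ?_, ?_⟩
    · intro x hx
      rw [Finset.coe_singleton, Set.mem_singleton_iff] at hx
      rw [hx]
      exact 𝔚.inv_f_mem_sectionsOn ha
    · intro s hs
      have hs' := (isSectionOn_iff_of_le hle).1 hs
      obtain ⟨g, hg⟩ := exists_germ_eq_of_forall_isRegularAt (𝔚.genericPoint_mem_opens t) hs'
      have e : algebraMap Γ(Y, 𝔚.opens t) Y.functionField g * (D.f (𝔚.chart a))⁻¹ = s := by
        rw [show algebraMap Γ(Y, 𝔚.opens t) Y.functionField g = D.f (𝔚.chart a) * s from hg,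
          mul_comm (D.f _) s, mul_inv_cancel_right₀ (D.f_ne_zero _)]
      rw [← e]
      exact Submodule.subset_span ⟨g, _, by simp, rfl⟩
  · intro s t hs hst y hy
    obtain ⟨a, ha⟩ := hs
    have hle : 𝔚.opens t ≤ D.U (𝔚.chart a) := (𝔚.opens_le_W (hst ha)).trans (𝔚.W_le_U a)
    refine stalkSpan_le ?_ fun f z hf hz => isRegularAt_mul_mem_stalkSpan hf hz
    intro z hz
    have hz' := (isSectionOn_iff_of_le hle).1 hz y hy
    have e : D.f (𝔚.chart a) * z * (D.f (𝔚.chart a))⁻¹ = z := by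
      rw [mul_comm (D.f _) z, mul_inv_cancel_right₀ (D.f_ne_zero _)]
    rw [← e]
    exact Submodule.subset_span ⟨_, _, hz', 𝔚.inv_f_mem_sectionsOn ha, rfl⟩

/-- **`Γ(T, 𝒪_T)` acts on `K(Y)` through `pr^*`** (`baseAlgebra`), compatibly in the sense of
`FracFamily.AlgCompat` for `Y = Y`, `ic = 𝟙`. [folklore] -/
theorem algCompat_baseAlgebra :
    @AlgCompat B Y pr Y _ (𝟙 Y) (baseAlgebra pr ⊤ 𝔚.genericPoint_mem) := by
  letI := baseAlgebra pr ⊤ 𝔚.genericPoint_mem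
  intro a
  rw [Category.id_comp]
  rfl

/-- The ordered Čech complex of `𝔚` is that of the family `s ↦ Γ(W_s, 𝒪(D))`. [folklore] -/
theorem complex_eq :
    letI := baseAlgebra pr ⊤ 𝔚.genericPoint_mem
    𝔚.complex = OrderedCech.complex 𝔚.sectionsOn 𝔚.sectionsOn_mono := rfl

end CartierDivisor.CechCover

/-! ### The named fact from Chow families -/

/-- **Görtz–Wedhorn II, Thm. 23.133 / Cor. 23.135 for the Čech complex of `𝒪(D)`, from Chow
families.** Suppose that for every affine noetherian `B`, every proper `g₀ : Z₀ → B`, every integral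
closed subscheme `ic : V ↪ Z₀` (with `Γ(B, 𝒪_B)` acting on `K(V)` through `V → Z₀ → B`) and every
finite cover of `V` with affine intersections there is a coherent rank-one family `𝓖 ⊆ 𝒦_V`
containing `1` all of whose Čech cohomology modules are finitely generated over `Γ(B, 𝒪_B)`
(assertion (3) in the printed proof of Görtz–Wedhorn II, Thm. 23.17, p. 425: Chow's lemma and
Serre's theorem). Then `cechComplex_pseudoCoherent_general` holds: by
`cechComplex_pseudoCoherent_general_of_finite_cohomology` it suffices to show that
`Hⁿ(Č•(𝔚, 𝒪(D)))` is finitely generated over `Γ(T, 𝒪_T)` for `T` affine integral noetherian of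
finite type over `K`, and this is `FracFamily.moduleFinite_homology_of_isCoherent`
(Thm. 23.17 / Cor. 23.18 by noetherian induction and rank-one dévissage) applied to the proper
`pr_T : X ×_K T → T`, `V = X ×_K T` and the coherent family `s ↦ Γ(W_s, 𝒪(D))`
(`CartierDivisor.CechCover.isCoherent_sectionsOn`).
[cite: GortzWedhorn2023, Thm. 23.133 proof Steps (I)–(III) (pp. 478–479) with Thm. 23.17 and Cor. 23.18 (pp. 424–425)] -/
theorem cechComplex_pseudoCoherent_general_of_chowFamilies
    (hChow : ∀ (B Z₀ : Scheme.{u}) (g₀ : Z₀ ⟶ B) [IsAffine B] [IsNoetherianRing Γ(B, ⊤)]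
      [IsProper g₀] (V : Scheme.{u}) [IsIntegral V] (ic : V ⟶ Z₀) [IsClosedImmersion ic]
      [Algebra Γ(B, ⊤) V.functionField], AlgCompat B Z₀ g₀ V ic →
      ∀ {ι : Type} [LinearOrder ι] [Fintype ι] (𝔘 : CoverData V ι), 𝔘.U ∅ = ⊤ →
        ∃ (G : Finset ι → Submodule Γ(B, ⊤) V.functionField) (hG : IsCoherent 𝔘 G),
          (∀ t, (1 : V.functionField) ∈ G t) ∧
            ∀ i, Module.Finite Γ(B, ⊤) ((complex G hG.mono).homology i)) :
    cechComplex_pseudoCoherent_general.{u} := by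
  refine cechComplex_pseudoCoherent_general_of_finite_cohomology
    fun K _ X T _ _ _ _ _ _ D 𝔚 n => ?_
  haveI : IsSeparated (snd X T).left := isSeparated_snd_left X T
  haveI : IsProper (snd X T).left := inferInstanceAs (IsProper (pullback.snd X.hom T.hom))
  haveI : LocallyOfFiniteType (X ⊗ T).hom :=
    inferInstanceAs (LocallyOfFiniteType (pullback.fst X.hom T.hom ≫ X.hom))
  haveI : IsLocallyNoetherian (X ⊗ T).left := LocallyOfFiniteType.isLocallyNoetherian (X ⊗ T).hom
  letI := CartierDivisor.baseAlgebra (snd X T).left ⊤ 𝔚.genericPoint_mem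
  rw [𝔚.complex_eq]
  exact moduleFinite_homology_of_isCoherent (B := T.left) (Z₀ := (X ⊗ T).left)
    (g₀ := (snd X T).left)
    (fun V _ ic _ _ hAlg _ _ _ 𝔘 h0 => hChow T.left (X ⊗ T).left (snd X T).left V ic hAlg 𝔘 h0)
    (X ⊗ T).left (𝟙 _) 𝔚.algCompat_baseAlgebra 𝔚.coverData 𝔚.opens_empty 𝔚.sectionsOn
    𝔚.isCoherent_sectionsOn ⟨0, 𝔚.sectionsOn_ne_bot 0⟩ n

end Literature.AlgebraicGeometry.Motives

end
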